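import Mathlib.CategoryTheory.SingleObj
import Literature.AlgebraicGeometry.Frobenioids.BaseCategoryFSMTypeProofs
import HarnessLib

/-!
# Frobenioids I, §0: one-object categories of FSMFF-type are of FSM-type (the pattern behind Remark 3.1.3)

S. Mochizuki, *The geometry of Frobenioids I: the general theory*, Kyushu J. Math. **62** (2008), §0,
kurims p. 18: "if `C` is of FSM-type, then it is of FSMFF-type … no endomorphism of an object of a category of
FSMFF-type is an FSMI-morphism" [cite: MochizukiFrdI2008, §0 p.18]; Remark 3.1.3, p. 58: the one-object category
of `ℕ_{≥1}` is not of FSMFF-type [cite: MochizukiFrdI2008, Rem. 3.1.3 p.58].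

PROOF-ONLY companion (abc-iut cell, seat abc-iut-f-133 gen 2) of `CategoriesFactorization.lean` /
`BaseCategoryFSMTypeProofs.lean`, recording the GENERAL form of the tree's `not_isOfFSMFFType_singleObj_pnat`:
in a category all of whose objects are equal (e.g. `SingleObj M`), condition (a) of "FSMFF-type" makes every
non-invertible FSM-morphism begin with an FSMI ENDOmorphism, which condition (b) forbids — so such a category is
of FSMFF-type iff it is of FSM-type, i.e. iff every FSM-morphism is invertible; for a commutative
left-cancellative monoid `M` (where every arrow of `SingleObj M` is FSM) this happens iff `M` is a group.
Use (cell bookkeeping): these are exactly the admissibility conditions on a ONE-OBJECT base category `D` in the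
hypothesis "`D` of FSMFF-type" of [EtTh] Cor. 3.8 (`Cor38Hyp.fsmff`) that the cell's toy tempered Frobenioids
(`Toy`, `TwoPrimes`, `DegreeTwist`, …) must meet.  No definition is introduced; no statement of the paper is
strengthened.
-/

namespace Literature.AlgebraicGeometry.Frobenioids

open CategoryTheory

universe v u

variable {C : Type u} [Category.{v} C]

/-- In a category of FSMFF-type whose objects are all equal (a one-object category), every FSM-morphism is an
isomorphism: otherwise it factors as a chain of FSMI-morphisms (condition (a)) whose first member is an FSMI
endomorphism, contradicting "no endomorphism … is an FSMI-morphism" (§0 p. 18).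
[cite: MochizukiFrdI2008, §0 p.18] -/
theorem IsOfFSMFFType.isIso_of_isFSM_of_subsingleton [Subsingleton C] (h : IsOfFSMFFType C) {A B : C}
    (f : A ⟶ B) (hf : IsFSM f) : IsIso f := by
  by_contra hi
  obtain ⟨n, hn⟩ := h.factors f hf hi
  obtain ⟨X, ψ, hψ⟩ := hn.exists_isFSMI
  obtain rfl : X = A := Subsingleton.elim _ _
  exact h.not_isFSMI_of_endomorphism ψ hψ

/-- A one-object category of FSMFF-type is of FSM-type (§0 p. 18, converse direction for one-object
categories). [cite: MochizukiFrdI2008, §0 p.18] -/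
theorem IsOfFSMFFType.isOfFSMType_of_subsingleton [Subsingleton C] (h : IsOfFSMFFType C) : IsOfFSMType C :=
  ⟨fun f hf => h.isIso_of_isFSM_of_subsingleton f hf⟩

/-- For a one-object category, "of FSMFF-type" and "of FSM-type" are equivalent (§0 p. 18: FSM-type ⇒
FSMFF-type in general; the converse by `isOfFSMType_of_subsingleton`). [cite: MochizukiFrdI2008, §0 p.18] -/
theorem isOfFSMFFType_iff_isOfFSMType_of_subsingleton [Subsingleton C] : IsOfFSMFFType C ↔ IsOfFSMType C :=
  ⟨fun h => h.isOfFSMType_of_subsingleton, fun h => h.isOfFSMFFType⟩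

/-- In `SingleObj M` an arrow is an isomorphism iff it is a unit of `M`. [folklore] -/
private theorem singleObj_isIso_iff_isUnit {M : Type u} [Monoid M] {x y : SingleObj M} (f : x ⟶ y) :
    IsIso f ↔ IsUnit (show M from f) := by
  constructor
  · intro hf
    refine ⟨⟨f, inv f, ?_, ?_⟩, rfl⟩
    · have h := IsIso.inv_hom_id f
      rwa [SingleObj.comp_as_mul, SingleObj.id_as_one] at h
    · have h := IsIso.hom_inv_id f
      rwa [SingleObj.comp_as_mul, SingleObj.id_as_one] at h
  · rintro ⟨u, hu⟩
    refine ⟨⟨(↑u⁻¹ : M), ?_, ?_⟩⟩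
    · rw [SingleObj.comp_as_mul, SingleObj.id_as_one, ← hu, Units.inv_mul]
    · rw [SingleObj.comp_as_mul, SingleObj.id_as_one, ← hu, Units.mul_inv]

/-- **Remark 3.1.3, general form**: for a commutative left-cancellative monoid `M` (every arrow of `SingleObj M`
is then an FSM-morphism, tree `SingleObj.isFSM`), the one-object category `SingleObj M` is of FSMFF-type if and
only if every element of `M` is invertible.  (`M = ℕ_{≥1}`: the tree's `not_isOfFSMFFType_singleObj_pnat`.)
[cite: MochizukiFrdI2008, Rem. 3.1.3 p.58] -/
theorem isOfFSMFFType_singleObj_iff_forall_isUnit {M : Type u} [CommMonoid M] [IsLeftCancelMul M] :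
    IsOfFSMFFType (SingleObj M) ↔ ∀ m : M, IsUnit m := by
  constructor
  · intro h m
    have hi : IsIso (show SingleObj.star M ⟶ SingleObj.star M from m) :=
      h.isIso_of_isFSM_of_subsingleton _ (SingleObj.isFSM _)
    exact (singleObj_isIso_iff_isUnit _).mp hi
  · intro h
    exact IsOfFSMType.isOfFSMFFType ⟨fun f _ => (singleObj_isIso_iff_isUnit f).mpr (h f)⟩

/-- In particular the one-object category of a commutative left-cancellative monoid with a non-unit (e.g.
`ℕ_{≥1}`, `ℕ`, a free commutative monoid) is never of FSMFF-type. [cite: MochizukiFrdI2008, Rem. 3.1.3 p.58] -/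
theorem not_isOfFSMFFType_singleObj_of_not_isUnit {M : Type u} [CommMonoid M] [IsLeftCancelMul M] {m : M}
    (hm : ¬ IsUnit m) : ¬ IsOfFSMFFType (SingleObj M) :=
  fun h => hm (isOfFSMFFType_singleObj_iff_forall_isUnit.mp h m)

end Literature.AlgebraicGeometry.Frobenioids
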